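import Mathlib

/-!
# LangWeilTransfer, support item `TameResolution` (stmt-ValiantsHypothesis-6378) — the Bézout
# cofactors of the resultant as EXPLICIT adjugate entries of the Sylvester matrix

Route `LangWeilTransfer` of `ValiantsHypothesis` (conditional route; honest framing: bookkeeping,
nothing here bears on VP ≠ VNP). The one risk named in the quantitative roadmap of val-lit-p6 g9:
Mathlib's `Polynomial.exists_mul_add_mul_eq_C_resultant` produces the cofactors `f A + g B = Res`
ABSTRACTLY, so no height bound follows. Here the same cofactors are written out: the coefficients
of `B` (the cofactor of `g`) are the entries `adj(Syl(f, g))_{i, 0}` (`i < m`) of the adjugate of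
the Sylvester matrix, and those of `A` are the entries `adj(Syl)_{m + i, 0}`; with
`LangWeilTransferTameResolutionDetWeight` this bounds their weights and degrees.

* `coe_fst_adjSylvester`, `coe_snd_adjSylvester` — the two components of `adjSylvester f g ⟨P, _⟩`
  as explicit sums `Σ_i (adj(Syl) *ᵥ coeffs P)_… X^i`;
* `exists_bezout_explicit` — `∃ A B`, `f A + g B = C (Res f g)`, `deg A < n`, `deg B < m`, and the
  coefficient formulas `B.coeff i = adj(Syl)_{castAdd i, 0}`, `A.coeff i = adj(Syl)_{natAdd i, 0}`.
-/

noncomputable section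

open Polynomial

-- the summit and the problem share the name `ValiantsHypothesis` (D-0017 single-conjunct layout)
set_option linter.dupNamespace false

namespace Summit.ValiantsHypothesis.ValiantsHypothesis.Theorems.LangWeilTransfer

variable {R : Type*} [CommRing R] {m n : ℕ}

/-- The first component of `adjSylvester f g P`, as a polynomial:
`Σ_{i < m} (adj(Syl) *ᵥ coeffs(P))_{castAdd i} · X^i`. -/
theorem coe_fst_adjSylvester (f g : R[X]) (P : R[X]_(m + n)) :
    ((adjSylvester f g P).1 : R[X]) =
      ∑ i : Fin m, (Matrix.mulVec (sylvester f g m n).adjugate (fun j => (P : R[X]).coeff j)) (Fin.castAdd n i) • X ^ (i : ℕ) := by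
  have h : adjSylvester f g P = ∑ j : Fin (m + n),
      (Matrix.mulVec (sylvester f g m n).adjugate (fun j => (P : R[X]).coeff j)) j • degreeLT.basisProd R m n j := by
    rw [adjSylvester, Matrix.toLin_apply]
    rfl
  rw [h, Fin.sum_univ_add]
  simp only [Prod.fst_add, Prod.fst_sum, Prod.smul_fst, degreeLT.basisProd_castAdd, degreeLT.basisProd_natAdd,
    smul_zero, Finset.sum_const_zero, add_zero]
  rw [Submodule.coe_sum]
  refine Finset.sum_congr rfl fun i _ => ?_
  rw [Submodule.coe_smul, degreeLT.basis_val]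

/-- The second component of `adjSylvester f g P`, as a polynomial:
`Σ_{i < n} (adj(Syl) *ᵥ coeffs(P))_{natAdd i} · X^i`. -/
theorem coe_snd_adjSylvester (f g : R[X]) (P : R[X]_(m + n)) :
    ((adjSylvester f g P).2 : R[X]) =
      ∑ i : Fin n, (Matrix.mulVec (sylvester f g m n).adjugate (fun j => (P : R[X]).coeff j)) (Fin.natAdd m i) • X ^ (i : ℕ) := by
  have h : adjSylvester f g P = ∑ j : Fin (m + n),
      (Matrix.mulVec (sylvester f g m n).adjugate (fun j => (P : R[X]).coeff j)) j • degreeLT.basisProd R m n j := by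
    rw [adjSylvester, Matrix.toLin_apply]
    rfl
  rw [h, Fin.sum_univ_add]
  simp only [Prod.snd_add, Prod.snd_sum, Prod.smul_snd, degreeLT.basisProd_castAdd, degreeLT.basisProd_natAdd,
    smul_zero, Finset.sum_const_zero, zero_add]
  rw [Submodule.coe_sum]
  refine Finset.sum_congr rfl fun i _ => ?_
  rw [Submodule.coe_smul, degreeLT.basis_val]

/-- Coefficients of `Σ_i c_i X^i` over `Fin k`. -/
theorem coeff_sum_fin_smul_X_pow {k : ℕ} (c : Fin k → R) (i : ℕ) :
    (∑ j : Fin k, c j • (X : R[X]) ^ (j : ℕ)).coeff i = if h : i < k then c ⟨i, h⟩ else 0 := by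
  rw [finsetSum_coeff]
  simp only [coeff_smul, coeff_X_pow, smul_eq_mul, mul_ite, mul_one, mul_zero]
  split_ifs with h
  · rw [Finset.sum_eq_single ⟨i, h⟩]
    · simp
    · intro j _ hj
      rw [if_neg]
      intro hij
      exact hj (Fin.ext hij.symm)
    · intro hh; exact absurd (Finset.mem_univ _) hh
  · refine Finset.sum_eq_zero fun j _ => ?_
    rw [if_neg]
    intro hij
    exact h (hij ▸ j.is_lt)

/-- **Explicit Bézout cofactors.** For `deg f ≤ m`, `deg g ≤ n`, `(m, n) ≠ (0, 0)`: there are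
`A, B` with `f A + g B = C (Res(f, g))`, `deg A < n`, `deg B < m`, whose coefficients are the
entries of the first column of the adjugate of the Sylvester matrix:
`B.coeff i = adj(Syl)_{castAdd i, 0}` (`i < m`), `A.coeff i = adj(Syl)_{natAdd i, 0}` (`i < n`). -/
theorem exists_bezout_explicit (f g : R[X]) (hf : f.natDegree ≤ m) (hg : g.natDegree ≤ n)
    (H : m ≠ 0 ∨ n ≠ 0) :
    ∃ A B : R[X], A.degree < n ∧ B.degree < m ∧ f * A + g * B = C (resultant f g m n) ∧
      (∀ i : ℕ, B.coeff i = if h : i < m then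
        (sylvester f g m n).adjugate (Fin.castAdd n ⟨i, h⟩) ⟨0, by omega⟩ else 0) ∧
      (∀ i : ℕ, A.coeff i = if h : i < n then
        (sylvester f g m n).adjugate (Fin.natAdd m ⟨i, h⟩) ⟨0, by omega⟩ else 0) := by
  classical
  nontriviality R
  have hmn : 0 < m + n := by omega
  let e : R[X]_(m + n) := ⟨1, by
    rw [Polynomial.mem_degreeLT, degree_one, ← Nat.cast_zero]
    exact_mod_cast hmn⟩
  set Xp := adjSylvester f g e with hXp
  have hmain : ((sylvesterMap f g hf hg Xp)).1 = _ :=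
    congr(($(sylveserMap_comp_adjSylvester f g hf hg) e).1)
  -- the vector `adj *ᵥ coeffs(1)` is the first column of the adjugate
  have hvec : ∀ j, (Matrix.mulVec (sylvester f g m n).adjugate (fun j => (e : R[X]).coeff j)) j =
      (sylvester f g m n).adjugate j ⟨0, hmn⟩ := by
    intro j
    change ∑ i, (sylvester f g m n).adjugate j i * (1 : R[X]).coeff i = _
    rw [Finset.sum_eq_single ⟨0, hmn⟩]
    · rw [coeff_one, if_pos rfl, mul_one]
    · intro i _ hi
      rw [coeff_one, if_neg, mul_zero]
      intro h0; exact hi (Fin.ext h0)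
    · intro hh; exact absurd (Finset.mem_univ _) hh
  have he : (e : R[X]) = 1 := rfl
  refine ⟨Xp.2, Xp.1, by simpa [Polynomial.mem_degreeLT, -SetLike.coe_mem] using Xp.2.2,
    by simpa [Polynomial.mem_degreeLT, -SetLike.coe_mem] using Xp.1.2,
    by simpa [Algebra.smul_def, he] using hmain, fun i => ?_, fun i => ?_⟩
  · rw [hXp, coe_fst_adjSylvester, coeff_sum_fin_smul_X_pow]
    split_ifs with h
    · rw [hvec]
    · rfl
  · rw [hXp, coe_snd_adjSylvester, coeff_sum_fin_smul_X_pow]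
    split_ifs with h
    · rw [hvec]
    · rfl

end Summit.ValiantsHypothesis.ValiantsHypothesis.Theorems.LangWeilTransfer
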